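import Summits.AtomisticToContinuum.Crystallization.Theorems.ExcessDecayLiouvillePhononStabilityCertSlice
import Summits.AtomisticToContinuum.Crystallization.Theorems.ExcessDecayLiouvillePhononStabilityCertPsi

/-!
# Near-certificate layer V5-b: coordinate slices of the class model terms (lead c2, vertex scheme)

Support file for crux `PhononStability` (stmt-AtomisticToContinuum-9333), line `contragredient-window-collapse`.

The class model term of the vertex scheme is `ω̃(ρ̄ + P(y))·P_c(Z(y))(w) + ψ̃(ρ̄ + P(y))·P_c(Λ(y))(w)` with a sparse
polynomial `P` (the squared bond length, `rhoPolyGen`) and polynomial matrices `Z` (`ζ̂ζ̂ᵀ`, `LmatP`) and `Λ`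
(`H_c − H_c X H_c`, `lowMatL`) in the nine chart variables.  Along the slice of variable `v` through a base point `y`
(`t ↦ Function.update y v t`) every polynomial of `v`-degree `≤ 2` splits into coefficient polynomials
(`spCoeff`, `mpCoeff`, `spEval_update`, `matVal_update`), so the class term becomes the sum of two slice terms of
layer V5-a (`classModel_update`) whose explicit second derivative is the pair form of an explicit matrix
(`g2_pair_eq`).  Pair forms are monotone in the matrix (`pairEvalR_mono`), which turns a matrix domination of that
second-derivative matrix into the scalar bound the concavity criterion wants.
-/

noncomputable section

open scoped BigOperators
open Set Function
open Summit.AtomisticToContinuum.Crystallization.Theorems.PhononStabilityNegative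

namespace Summit.AtomisticToContinuum.Crystallization.Theorems.PhononStabilityCWC.Cert

local notation "E3" => EuclideanSpace ℝ (Fin 3)

/-! ## Monomials along a coordinate slice -/

/-- multiplicity of the variable `v` in a monomial -/
def monoCount (v : ℕ) (m : Mono) : ℕ := m.count v

/-- the monomial with the variable `v` removed -/
def monoErase (v : ℕ) (m : Mono) : Mono := m.filter fun a => a ≠ v

/-- value of a cons monomial. [folklore] -/
theorem monoVal_cons' (x : ℕ → ℝ) (a : ℕ) (m : Mono) : monoVal x (a :: m) = x a * monoVal x m := by
  simp [monoVal]

/-- **a monomial along the slice of `v`:** `x^m (y[v ↦ t]) = t^{count} · x^{m ∖ v}(y)`. [folklore] -/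
theorem monoVal_update (x : ℕ → ℝ) (v : ℕ) (t : ℝ) (m : Mono) :
    monoVal (update x v t) m = t ^ monoCount v m * monoVal x (monoErase v m) := by
  induction m with
  | nil => simp [monoVal, monoCount, monoErase]
  | cons a m ih =>
      rw [monoVal_cons', ih]
      by_cases ha : a = v
      · subst ha
        have hc : monoCount a (a :: m) = monoCount a m + 1 := by simp [monoCount, List.count_cons_self]
        have he : monoErase a (a :: m) = monoErase a m := by simp [monoErase]
        rw [hc, he, update_self, pow_succ]
        ring
      · have hc : monoCount v (a :: m) = monoCount v m := by
          simp [monoCount, ha]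
        have he : monoErase v (a :: m) = a :: monoErase v m := by simp [monoErase, ha]
        rw [hc, he, monoVal_cons', update_of_ne ha]
        ring

/-! ## Coefficient polynomials of a scalar sparse polynomial -/

/-- the coefficient polynomial of `t^k` along the slice of `v` -/
def spCoeff (p : SPoly) (v k : ℕ) : SPoly := (p.filter fun e => monoCount v e.1 = k).map fun e => (monoErase v e.1, e.2)

/-- `v`-degree at most `d` -/
def spDegLe (p : SPoly) (v d : ℕ) : Bool := p.all fun e => decide (monoCount v e.1 ≤ d)

/-- coefficient polynomials of a cons. [folklore] -/
theorem spCoeff_cons (e : Mono × ℚ) (p : SPoly) (v k : ℕ) :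
    spCoeff (e :: p) v k = if monoCount v e.1 = k then (monoErase v e.1, e.2) :: spCoeff p v k else spCoeff p v k := by
  unfold spCoeff
  by_cases h : monoCount v e.1 = k <;> simp [h]

/-- **a scalar polynomial of `v`-degree `≤ 2` along the slice of `v`.** [folklore] -/
theorem spEval_update (p : SPoly) (v : ℕ) (hp : spDegLe p v 2 = true) (x : ℕ → ℝ) (t : ℝ) :
    spEval p (update x v t) =
      spEval (spCoeff p v 0) x + t * spEval (spCoeff p v 1) x + t ^ 2 * spEval (spCoeff p v 2) x := by
  induction p with
  | nil => simp [spCoeff]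
  | cons e p ih =>
      have hp' : spDegLe p v 2 = true := by
        simp only [spDegLe, List.all_cons, Bool.and_eq_true] at hp ⊢; exact hp.2
      have hd : monoCount v e.1 ≤ 2 := by
        simp only [spDegLe, List.all_cons, Bool.and_eq_true, decide_eq_true_eq] at hp; exact hp.1
      rw [spEval_cons, ih hp', monoVal_update, spCoeff_cons, spCoeff_cons, spCoeff_cons]
      rcases Nat.lt_or_ge (monoCount v e.1) 1 with h0 | h1
      · have h : monoCount v e.1 = 0 := by omega
        simp only [h, if_true, show (0 : ℕ) ≠ 1 from by decide, show (0 : ℕ) ≠ 2 from by decide, if_false,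
          spEval_cons, pow_zero]
        ring
      · rcases Nat.lt_or_ge (monoCount v e.1) 2 with h1' | h2
        · have h : monoCount v e.1 = 1 := by omega
          simp only [h, if_true, show (1 : ℕ) ≠ 0 from by decide, show (1 : ℕ) ≠ 2 from by decide, if_false,
            spEval_cons, pow_one]
          ring
        · have h : monoCount v e.1 = 2 := by omega
          simp only [h, if_true, show (2 : ℕ) ≠ 0 from by decide, show (2 : ℕ) ≠ 1 from by decide, if_false,
            spEval_cons]
          ring

/-! ## Coefficient polynomials of a polynomial matrix -/

/-- the coefficient matrix polynomial of `t^k` along the slice of `v` -/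
def mpCoeff (L : List (Mono × Mat)) (v k : ℕ) : List (Mono × Mat) :=
  (L.filter fun e => monoCount v e.1 = k).map fun e => (monoErase v e.1, e.2)

/-- `v`-degree at most `d` -/
def mpDegLe (L : List (Mono × Mat)) (v d : ℕ) : Bool := L.all fun e => decide (monoCount v e.1 ≤ d)

/-- coefficient matrix polynomials of a cons. [folklore] -/
theorem mpCoeff_cons (e : Mono × Mat) (L : List (Mono × Mat)) (v k : ℕ) :
    mpCoeff (e :: L) v k = if monoCount v e.1 = k then (monoErase v e.1, e.2) :: mpCoeff L v k else mpCoeff L v k := by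
  unfold mpCoeff
  by_cases h : monoCount v e.1 = k <;> simp [h]

/-- **a polynomial matrix of `v`-degree `≤ 2` along the slice of `v`.** [folklore] -/
theorem matVal_update (L : List (Mono × Mat)) (v : ℕ) (hL : mpDegLe L v 2 = true) (x : ℕ → ℝ) (t : ℝ) (i j : Fin 3) :
    matVal (update x v t) L i j =
      matVal x (mpCoeff L v 0) i j + t * matVal x (mpCoeff L v 1) i j + t ^ 2 * matVal x (mpCoeff L v 2) i j := by
  induction L with
  | nil => simp [mpCoeff, matVal]
  | cons e L ih =>
      have hL' : mpDegLe L v 2 = true := by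
        simp only [mpDegLe, List.all_cons, Bool.and_eq_true] at hL ⊢; exact hL.2
      have hd : monoCount v e.1 ≤ 2 := by
        simp only [mpDegLe, List.all_cons, Bool.and_eq_true, decide_eq_true_eq] at hL; exact hL.1
      rw [matVal_cons, ih hL', monoVal_update, mpCoeff_cons, mpCoeff_cons, mpCoeff_cons]
      rcases Nat.lt_or_ge (monoCount v e.1) 1 with h0 | h1
      · have h : monoCount v e.1 = 0 := by omega
        simp only [h, if_true, show (0 : ℕ) ≠ 1 from by decide, show (0 : ℕ) ≠ 2 from by decide, if_false,
          matVal_cons, pow_zero]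
        ring
      · rcases Nat.lt_or_ge (monoCount v e.1) 2 with h1' | h2
        · have h : monoCount v e.1 = 1 := by omega
          simp only [h, if_true, show (1 : ℕ) ≠ 0 from by decide, show (1 : ℕ) ≠ 2 from by decide, if_false,
            matVal_cons, pow_one]
          ring
        · have h : monoCount v e.1 = 2 := by omega
          simp only [h, if_true, show (2 : ℕ) ≠ 0 from by decide, show (2 : ℕ) ≠ 1 from by decide, if_false,
            matVal_cons]
          ring

/-! ## Monotonicity of real pair forms in the matrix -/

/-- the quadratic-form order on real `3 × 3` coefficient arrays: `M ⪯ N` -/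
def MatLE (M N : Fin 3 → Fin 3 → ℝ) : Prop := ∀ u : Fin 3 → ℝ, bilR M u u ≤ bilR N u u

/-- **pair forms are monotone in the matrix.** [folklore] -/
theorem pairEvalR_mono {w : Label → E3} (hw : (support w).Finite) (c : BondClass) {M N : Fin 3 → Fin 3 → ℝ}
    (h : MatLE M N) : pairEvalR c M w ≤ pairEvalR c N w := by
  unfold pairEvalR
  exact (summable_pairR hw c M).tsum_le_tsum (fun _ => h _) (summable_pairR hw c N)

/-- pair forms of quadratic-form-nonnegative matrices are nonnegative. [folklore] -/
theorem pairEvalR_nonneg_of_psd (c : BondClass) {M : Fin 3 → Fin 3 → ℝ} (h : ∀ u : Fin 3 → ℝ, 0 ≤ bilR M u u)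
    (w : Label → E3) : 0 ≤ pairEvalR c M w :=
  tsum_nonneg fun _ => h _

/-! ## The class model term and its slices -/

/-- **the class model term** `ω̃(ρ̄ + P(y))·P_c(Z(y)) + ψ̃(ρ̄ + P(y))·P_c(Λ(y))`. -/
def classModel (ρbar : ℚ) (P : SPoly) (Z Λ : List (Mono × Mat)) (c : BondClass) (y : ℕ → ℝ) (w : Label → E3) : ℝ :=
  omegaT ((ρbar : ℝ) + spEval P y) * pairEvalR c (matVal y Z) w + psiT ((ρbar : ℝ) + spEval P y) * pairEvalR c (matVal y Λ) w

/-- the `ω̃`-slice term of a class along variable `v` through the base point `x` -/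
def sliceOmega (ρbar : ℚ) (P : SPoly) (Z : List (Mono × Mat)) (c : BondClass) (v : ℕ) (x : ℕ → ℝ) (w : Label → E3) :
    SliceTerm where
  φ := omegaT
  φ1 := omegaT1
  φ2 := omegaT2
  r0 := (ρbar : ℝ) + spEval (spCoeff P v 0) x
  r1 := spEval (spCoeff P v 1) x
  r2 := spEval (spCoeff P v 2) x
  a0 := pairEvalR c (matVal x (mpCoeff Z v 0)) w
  a1 := pairEvalR c (matVal x (mpCoeff Z v 1)) w
  a2 := pairEvalR c (matVal x (mpCoeff Z v 2)) w

/-- the `ψ̃`-slice term of a class along variable `v` through the base point `x` -/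
def slicePsi (ρbar : ℚ) (P : SPoly) (Λ : List (Mono × Mat)) (c : BondClass) (v : ℕ) (x : ℕ → ℝ) (w : Label → E3) :
    SliceTerm where
  φ := psiT
  φ1 := psiT1
  φ2 := psiT2
  r0 := (ρbar : ℝ) + spEval (spCoeff P v 0) x
  r1 := spEval (spCoeff P v 1) x
  r2 := spEval (spCoeff P v 2) x
  a0 := pairEvalR c (matVal x (mpCoeff Λ v 0)) w
  a1 := pairEvalR c (matVal x (mpCoeff Λ v 1)) w
  a2 := pairEvalR c (matVal x (mpCoeff Λ v 2)) w

/-- the `ω̃`-slice term is twice differentiable in the sense of layer V5-a. [folklore] -/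
theorem sliceOmega_derivOK (ρbar : ℚ) (P : SPoly) (Z : List (Mono × Mat)) (c : BondClass) (v : ℕ) (x : ℕ → ℝ)
    (w : Label → E3) : (sliceOmega ρbar P Z c v x w).DerivOK :=
  ⟨fun _ hρ => hasDerivAt_omegaT hρ.ne', fun _ hρ => hasDerivAt_omegaT1 hρ.ne'⟩

/-- the `ψ̃`-slice term is twice differentiable in the sense of layer V5-a. [folklore] -/
theorem slicePsi_derivOK (ρbar : ℚ) (P : SPoly) (Λ : List (Mono × Mat)) (c : BondClass) (v : ℕ) (x : ℕ → ℝ)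
    (w : Label → E3) : (slicePsi ρbar P Λ c v x w).DerivOK :=
  ⟨fun _ hρ => hasDerivAt_psiT hρ.ne', fun _ hρ => hasDerivAt_psiT1 hρ.ne'⟩

/-- the pair form of a polynomial matrix along a slice is the quadratic `a0 + a1 t + a2 t²`. [folklore] -/
theorem pairEvalR_matVal_update {w : Label → E3} (hw : (support w).Finite) (c : BondClass) (L : List (Mono × Mat))
    (v : ℕ) (hL : mpDegLe L v 2 = true) (x : ℕ → ℝ) (t : ℝ) :
    pairEvalR c (matVal (update x v t) L) w = pairEvalR c (matVal x (mpCoeff L v 0)) w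
      + pairEvalR c (matVal x (mpCoeff L v 1)) w * t + pairEvalR c (matVal x (mpCoeff L v 2)) w * t ^ 2 := by
  have h : matVal (update x v t) L = fun i j => matVal x (mpCoeff L v 0) i j
      + (t * matVal x (mpCoeff L v 1) i j + t ^ 2 * matVal x (mpCoeff L v 2) i j) := by
    funext i j; rw [matVal_update L v hL]; ring
  rw [h, pairEvalR_add hw, pairEvalR_add hw, pairEvalR_smul, pairEvalR_smul]
  ring

/-- **THE CLASS MODEL TERM ALONG A SLICE is the sum of its two slice terms.** [folklore] -/
theorem classModel_update {w : Label → E3} (hw : (support w).Finite) (ρbar : ℚ) {P : SPoly} {Z Λ : List (Mono × Mat)}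
    (c : BondClass) {v : ℕ} (hP : spDegLe P v 2 = true) (hZ : mpDegLe Z v 2 = true) (hΛ : mpDegLe Λ v 2 = true)
    (x : ℕ → ℝ) (t : ℝ) :
    classModel ρbar P Z Λ c (update x v t) w = (sliceOmega ρbar P Z c v x w).g t + (slicePsi ρbar P Λ c v x w).g t := by
  unfold classModel SliceTerm.g SliceTerm.rho SliceTerm.q
  rw [spEval_update P v hP, pairEvalR_matVal_update hw c Z v hZ, pairEvalR_matVal_update hw c Λ v hΛ]
  simp only [sliceOmega, slicePsi]
  ring_nf

/-! ## The second derivative of a slice term is a pair form -/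

/-- the second-derivative matrix of a slice term with coefficient matrices `K0, K1, K2` at slice parameter `t`:
`(φ″ρ′² + 2 r2 φ′)(K0 + t K1 + t² K2) + 2 φ′ ρ′ (K1 + 2t K2) + 2 φ K2`. -/
def g2Mat (s : SliceTerm) (K0 K1 K2 : Fin 3 → Fin 3 → ℝ) (t : ℝ) : Fin 3 → Fin 3 → ℝ := fun i j =>
  (s.φ2 (s.rho t) * s.rho1 t ^ 2 + 2 * s.r2 * s.φ1 (s.rho t)) * (K0 i j + t * K1 i j + t ^ 2 * K2 i j)
    + 2 * s.φ1 (s.rho t) * s.rho1 t * (K1 i j + 2 * t * K2 i j) + 2 * s.φ (s.rho t) * K2 i j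

/-- **the explicit second derivative of a slice term whose factor coefficients are the pair forms of `K0, K1, K2` is
the pair form of `g2Mat`.** [folklore] -/
theorem g2_pair_eq {w : Label → E3} (hw : (support w).Finite) (c : BondClass) (s : SliceTerm)
    (K0 K1 K2 : Fin 3 → Fin 3 → ℝ) (h0 : s.a0 = pairEvalR c K0 w) (h1 : s.a1 = pairEvalR c K1 w)
    (h2 : s.a2 = pairEvalR c K2 w) (t : ℝ) : s.g2 t = pairEvalR c (g2Mat s K0 K1 K2 t) w := by
  have hsplit : g2Mat s K0 K1 K2 t = fun i j =>
      ((s.φ2 (s.rho t) * s.rho1 t ^ 2 + 2 * s.r2 * s.φ1 (s.rho t)) * K0 i j)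
        + ((((s.φ2 (s.rho t) * s.rho1 t ^ 2 + 2 * s.r2 * s.φ1 (s.rho t)) * t + 2 * s.φ1 (s.rho t) * s.rho1 t) * K1 i j)
        + (((s.φ2 (s.rho t) * s.rho1 t ^ 2 + 2 * s.r2 * s.φ1 (s.rho t)) * t ^ 2
            + 2 * s.φ1 (s.rho t) * s.rho1 t * (2 * t) + 2 * s.φ (s.rho t)) * K2 i j)) := by
    funext i j; simp only [g2Mat]; ring
  rw [hsplit, pairEvalR_add hw, pairEvalR_add hw, pairEvalR_smul, pairEvalR_smul, pairEvalR_smul, ← h0, ← h1, ← h2]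
  simp only [SliceTerm.g2, SliceTerm.q, SliceTerm.q1]
  ring

/-- the second derivative of the `ω̃`-slice term as a pair form. [folklore] -/
theorem sliceOmega_g2 {w : Label → E3} (hw : (support w).Finite) (ρbar : ℚ) (P : SPoly) (Z : List (Mono × Mat))
    (c : BondClass) (v : ℕ) (x : ℕ → ℝ) (t : ℝ) :
    (sliceOmega ρbar P Z c v x w).g2 t = pairEvalR c (g2Mat (sliceOmega ρbar P Z c v x w)
      (matVal x (mpCoeff Z v 0)) (matVal x (mpCoeff Z v 1)) (matVal x (mpCoeff Z v 2)) t) w :=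
  g2_pair_eq hw c _ _ _ _ rfl rfl rfl t

/-- the second derivative of the `ψ̃`-slice term as a pair form. [folklore] -/
theorem slicePsi_g2 {w : Label → E3} (hw : (support w).Finite) (ρbar : ℚ) (P : SPoly) (Λ : List (Mono × Mat))
    (c : BondClass) (v : ℕ) (x : ℕ → ℝ) (t : ℝ) :
    (slicePsi ρbar P Λ c v x w).g2 t = pairEvalR c (g2Mat (slicePsi ρbar P Λ c v x w)
      (matVal x (mpCoeff Λ v 0)) (matVal x (mpCoeff Λ v 1)) (matVal x (mpCoeff Λ v 2)) t) w :=
  g2_pair_eq hw c _ _ _ _ rfl rfl rfl t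

/-- **DOMINATION:** if the two second-derivative matrices of a class along a slice are dominated (in the quadratic-form
order, for every `t` of the slice) by `W`, the explicit second derivative of the class slice sum is at most `P_c(W)(w)`.
[folklore] -/
theorem classSlice_g2_le {w : Label → E3} (hw : (support w).Finite) (ρbar : ℚ) (P : SPoly) (Z Λ : List (Mono × Mat))
    (c : BondClass) (v : ℕ) (x : ℕ → ℝ) {a b : ℝ} {W : Fin 3 → Fin 3 → ℝ}
    (hdom : ∀ t ∈ Icc a b, MatLE (fun i j =>
        g2Mat (sliceOmega ρbar P Z c v x w) (matVal x (mpCoeff Z v 0)) (matVal x (mpCoeff Z v 1)) (matVal x (mpCoeff Z v 2)) t i j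
        + g2Mat (slicePsi ρbar P Λ c v x w) (matVal x (mpCoeff Λ v 0)) (matVal x (mpCoeff Λ v 1)) (matVal x (mpCoeff Λ v 2)) t i j) W) :
    ∀ t ∈ Icc a b, sliceSum2 [sliceOmega ρbar P Z c v x w, slicePsi ρbar P Λ c v x w] 0 t ≤ pairEvalR c W w := by
  intro t ht
  unfold sliceSum2
  simp only [List.map_cons, List.map_nil, List.sum_cons, List.sum_nil, add_zero, mul_zero, sub_zero]
  rw [sliceOmega_g2 hw, slicePsi_g2 hw, ← pairEvalR_add hw]
  exact pairEvalR_mono hw c (hdom t ht)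

/-- Anchor of this support file (registered stub of the line skeleton, lead c2): the constant monomial has no `v`. -/
theorem stub_certSliceRep : spCoeff [([], 1)] 1 0 = [([], 1)] := by
  rfl

end Summit.AtomisticToContinuum.Crystallization.Theorems.PhononStabilityCWC.Cert

end
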